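import Mathlib
import HarnessLib
import Summits.Ventures.LatticeQCDFlow.Exactness.NCMCGeneralSpaceKernel
import Summits.Ventures.LatticeQCDFlow.Exactness.NCMCGeneralSpaceOverlap

/-!
# The occupancy law of the expanded ensemble on a general state space, and the flow balance between the lanes

HONEST FRAMING: exact (Metropolis-corrected) sampling algorithms for lattice gauge theory;
figures of merit are autocorrelation/cost numbers at stated couplings and volumes; no
continuum-physics claim.

Venture `LatticeQCDFlow` (cell pub-lqcd), topic `Exactness`; FANOUT row 13 (`eng-snf`, GEN-11).
NEW WORK of the cell (elementary), not a published result; nothing is cited as a fact.  General-state-space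
counterpart of the finite `NCMCExpandedEnsemble.ncmc_occupancy` (row 13 GEN-8), in the setting of
`NCMCGeneralSpaceKernel.lean` (the joint weight `Π_c = jointWeight c ν₀ ν₁` of the expanded ensemble
`{prior, target} × Ω`, invariant under the Metropolized switch for every Crooks pair and every `c`) and
`NCMCGeneralSpaceOverlap.lean` (`P_F`, `P_R`, `e^{−ΔF} = Z₁/Z₀`, lane acceptance rates).

WHY.  The `ncmc` mode of `latflow-snf` reports the OCCUPANCY of the target level and the two lane
acceptance rates; GEN-8 found the occupancy law to be the sharpest run-time exactness test of a switch
chain (planted pairing defects move it by 60–130 σ while observables stay within 1–2 σ).  This file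
types what those numbers are in stationarity on the engine's state space.

## Content (`p(c)` = `Π_c(target level) / Π_c(everything)`, the stationary occupancy)

* `toReal_jointWeight_targetLevel`, `toReal_jointWeight_univ`, `jointWeight_univ` — level masses
  `e^{c} Z₁` and `Z₀ + e^{c} Z₁` as real numbers.
* **`occupancy_eq_sigmoid`** — THE OCCUPANCY LAW: `p(c) = σ(c − ΔF) = 1/(1 + e^{−(c−ΔF)})`
  (`σ = Real.sigmoid`); `occupancy_eq_half_iff` (`p(c) = ½ ↔ c = ΔF`), `occupancy_strictMono`;
  **`log_occupancy_div_eq`** — `log (p/(1 − p)) = c − ΔF`: the engine's `dF_occ = c − logit(occupancy)`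
  reads `ΔF` exactly in population, for every pair of finite non-zero level weights.
* **`CrooksPair.occupancy_mul_accept_rev_eq`** — FLOW BALANCE BETWEEN THE LANES: in stationarity
  `(1 − p(c)) · a_F(c) = p(c) · a_R(c)`, `a_F(c) = E_{P_F}[min(1, e^{−(W−c)})]` and
  `a_R(c) = E_{P_R}[min(1, e^{W−c})]` the two lane acceptance rates — the rate of accepted up-switches
  equals the rate of accepted down-switches (`levelBalance` on the whole space), a three-number
  consistency identity between reported occupancy and lane acceptances, for EVERY Crooks pair.

Nothing is claimed about finite-sample fluctuations or autocorrelations of the reported numbers.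
-/

namespace Summit.Ventures.LatticeQCDFlow.Exactness.GeneralNCMC

open MeasureTheory ProbabilityTheory Set Filter
open scoped ENNReal

variable {Ω E : Type*} [MeasurableSpace Ω] [MeasurableSpace E]

/-! ## Level masses as real numbers -/

/-- Total mass of the joint weight: `Π_c(everything) = Z₀ + e^{c} Z₁`. -/
theorem jointWeight_univ (c : ℝ) (ν₀ ν₁ : Measure Ω) :
    jointWeight c ν₀ ν₁ univ = ν₀ univ + ENNReal.ofReal (Real.exp c) * ν₁ univ := by
  rw [jointWeight_apply c ν₀ ν₁ MeasurableSet.univ, preimage_univ, preimage_univ]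

/-- `Π_c(target level) = e^{c} Z₁` as a real number. -/
theorem toReal_jointWeight_targetLevel (c : ℝ) (ν₀ ν₁ : Measure Ω) :
    (jointWeight c ν₀ ν₁ (targetLevel Ω)).toReal = Real.exp c * (ν₁ univ).toReal := by
  rw [jointWeight_targetLevel, ENNReal.toReal_mul, ENNReal.toReal_ofReal (Real.exp_pos c).le]

/-- `Π_c(everything) = Z₀ + e^{c} Z₁` as a real number (finite level weights). -/
theorem toReal_jointWeight_univ (c : ℝ) (ν₀ ν₁ : Measure Ω) [IsFiniteMeasure ν₀] [IsFiniteMeasure ν₁] :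
    (jointWeight c ν₀ ν₁ univ).toReal = (ν₀ univ).toReal + Real.exp c * (ν₁ univ).toReal := by
  rw [jointWeight_univ, ENNReal.toReal_add (measure_ne_top ν₀ univ)
      (ENNReal.mul_ne_top ENNReal.ofReal_ne_top (measure_ne_top ν₁ univ)),
    ENNReal.toReal_mul, ENNReal.toReal_ofReal (Real.exp_pos c).le]

/-! ## The occupancy law -/

/-- **The occupancy law**: for finite non-zero level weights with `e^{−ΔF} = Z₁/Z₀`, the stationary
occupancy of the target level is `p(c) = e^{c} Z₁ / (Z₀ + e^{c} Z₁) = σ(c − ΔF)`. -/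
theorem occupancy_eq_sigmoid (c : ℝ) (ν₀ ν₁ : Measure Ω) [IsFiniteMeasure ν₀] [IsFiniteMeasure ν₁]
    (h0 : ν₀ univ ≠ 0) (h1 : ν₁ univ ≠ 0) {ΔF : ℝ}
    (hΔF : Real.exp (-ΔF) = ((ν₀ univ)⁻¹ * ν₁ univ).toReal) :
    (jointWeight c ν₀ ν₁ (targetLevel Ω)).toReal / (jointWeight c ν₀ ν₁ univ).toReal =
      Real.sigmoid (c - ΔF) := by
  have hz0 : 0 < (ν₀ univ).toReal := ENNReal.toReal_pos h0 (measure_ne_top ν₀ univ)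
  have hz1 : 0 < (ν₁ univ).toReal := ENNReal.toReal_pos h1 (measure_ne_top ν₁ univ)
  have hr : Real.exp (-ΔF) = (ν₀ univ).toReal⁻¹ * (ν₁ univ).toReal := by
    rw [hΔF, ENNReal.toReal_mul, ENNReal.toReal_inv]
  have hexp : Real.exp (-(c - ΔF)) = (Real.exp c)⁻¹ * ((ν₀ univ).toReal / (ν₁ univ).toReal) := by
    rw [show -(c - ΔF) = -c + ΔF by ring, Real.exp_add, Real.exp_neg, ← neg_neg ΔF, Real.exp_neg, hr]
    field_simp
  rw [toReal_jointWeight_targetLevel, toReal_jointWeight_univ, Real.sigmoid_def, hexp]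
  have hec : 0 < Real.exp c := Real.exp_pos c
  field_simp
  ring

/-- **`p(c) = ½` exactly at `c = ΔF`.** -/
theorem occupancy_eq_half_iff (c : ℝ) (ν₀ ν₁ : Measure Ω) [IsFiniteMeasure ν₀] [IsFiniteMeasure ν₁]
    (h0 : ν₀ univ ≠ 0) (h1 : ν₁ univ ≠ 0) {ΔF : ℝ}
    (hΔF : Real.exp (-ΔF) = ((ν₀ univ)⁻¹ * ν₁ univ).toReal) :
    (jointWeight c ν₀ ν₁ (targetLevel Ω)).toReal / (jointWeight c ν₀ ν₁ univ).toReal = 1 / 2 ↔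
      c = ΔF := by
  rw [occupancy_eq_sigmoid c ν₀ ν₁ h0 h1 hΔF, show (1 / 2 : ℝ) = Real.sigmoid 0 by
    rw [Real.sigmoid_zero]; norm_num, Real.sigmoid_inj, sub_eq_zero]

/-- The occupancy is strictly increasing in `c`. -/
theorem occupancy_strictMono (ν₀ ν₁ : Measure Ω) [IsFiniteMeasure ν₀] [IsFiniteMeasure ν₁]
    (h0 : ν₀ univ ≠ 0) (h1 : ν₁ univ ≠ 0) {ΔF : ℝ}
    (hΔF : Real.exp (-ΔF) = ((ν₀ univ)⁻¹ * ν₁ univ).toReal) :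
    StrictMono fun c => (jointWeight c ν₀ ν₁ (targetLevel Ω)).toReal / (jointWeight c ν₀ ν₁ univ).toReal := by
  intro c c' hcc'
  simp only [occupancy_eq_sigmoid _ ν₀ ν₁ h0 h1 hΔF]
  exact Real.sigmoid_lt (by linarith)

/-- **`log (p/(1 − p)) = c − ΔF`** — the logit of the occupancy reads the free-energy difference:
the engine's `dF_occ = c − logit(occupancy)` is exact in population. -/
theorem log_occupancy_div_eq (c : ℝ) (ν₀ ν₁ : Measure Ω) [IsFiniteMeasure ν₀] [IsFiniteMeasure ν₁]
    (h0 : ν₀ univ ≠ 0) (h1 : ν₁ univ ≠ 0) {ΔF : ℝ}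
    (hΔF : Real.exp (-ΔF) = ((ν₀ univ)⁻¹ * ν₁ univ).toReal) :
    Real.log ((jointWeight c ν₀ ν₁ (targetLevel Ω)).toReal / (jointWeight c ν₀ ν₁ univ).toReal /
        (1 - (jointWeight c ν₀ ν₁ (targetLevel Ω)).toReal / (jointWeight c ν₀ ν₁ univ).toReal)) =
      c - ΔF := by
  rw [occupancy_eq_sigmoid c ν₀ ν₁ h0 h1 hΔF, ← Real.sigmoid_neg]
  have hratio : Real.sigmoid (c - ΔF) / Real.sigmoid (-(c - ΔF)) = Real.exp (c - ΔF) := by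
    rw [div_eq_iff (Real.sigmoid_pos _).ne', ← Real.sigmoid_mul_rexp_neg (c - ΔF), Real.exp_neg]
    have hec : Real.exp (c - ΔF) ≠ 0 := Real.exp_ne_zero _
    field_simp
  rw [hratio, Real.log_exp]

/-! ## Flow balance between the lanes -/

namespace CrooksPair

variable {ν₀ ν₁ : Measure Ω} {κF κR : Kernel Ω E} {s e : E → Ω} {W : E → ℝ}

/-- **Flow balance between the lanes.**  For every Crooks pair and every `c`, in stationarity the
rate of accepted up-switches equals the rate of accepted down-switches:
`(1 − p(c)) · E_{P_F}[min(1, e^{−(W−c)})] = p(c) · E_{P_R}[min(1, e^{W−c})]` — written with the level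
masses, `Z₀ · a_F(c) = e^{c} Z₁ · a_R(c)` (`levelBalance` on the whole space, normalised). -/
theorem occupancy_mul_accept_rev_eq [IsFiniteMeasure ν₀] [IsFiniteMeasure ν₁] [IsMarkovKernel κF]
    [IsMarkovKernel κR] (h0 : ν₀ univ ≠ 0) (h1 : ν₁ univ ≠ 0) (h : CrooksPair ν₀ ν₁ κF κR s e W)
    (c : ℝ) :
    (ν₀ univ).toReal * ∫ ε, min 1 (Real.exp (-(W ε - c))) ∂(fwdPathLaw ν₀ κF) =
      Real.exp c * (ν₁ univ).toReal * ∫ ε, min 1 (Real.exp (W ε - c)) ∂(fwdPathLaw ν₁ κR) := by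
  haveI := isProbabilityMeasure_fwdPathLaw ν₀ h0 κF
  haveI := isProbabilityMeasure_fwdPathLaw ν₁ h1 κR
  set ΔF : ℝ := Real.log (ν₀ univ).toReal - Real.log (ν₁ univ).toReal with hΔFdef
  have hΔF : Real.exp (-ΔF) = ((ν₀ univ)⁻¹ * ν₁ univ).toReal := exp_neg_freeEnergyDiff h0 h1
  have hz0 : 0 < (ν₀ univ).toReal := ENNReal.toReal_pos h0 (measure_ne_top ν₀ univ)
  have hz1 : 0 < (ν₁ univ).toReal := ENNReal.toReal_pos h1 (measure_ne_top ν₁ univ)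
  -- the two normalised rates differ by `e^{c−ΔF}` (`NCMCGeneralSpaceOverlap`), in real form
  have hmF : Measurable fun ε => min 1 (Real.exp (-(W ε - c))) :=
    measurable_const.min (Real.measurable_exp.comp (h.measurable_W.sub measurable_const).neg)
  have hmR : Measurable fun ε => min 1 (Real.exp (W ε - c)) :=
    measurable_const.min (Real.measurable_exp.comp (h.measurable_W.sub measurable_const))
  have key := h.lintegral_accF_eq_exp_mul_lintegral_accR h0 h1 hΔF c
  have hF : ∫ ε, min 1 (Real.exp (-(W ε - c))) ∂(fwdPathLaw ν₀ κF) =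
      (∫⁻ ε, accF c W ε ∂(fwdPathLaw ν₀ κF)).toReal := by
    rw [integral_eq_lintegral_of_nonneg_ae
      (Eventually.of_forall fun ε => le_min zero_le_one (Real.exp_pos _).le) hmF.aestronglyMeasurable]
    rfl
  have hR : ∫ ε, min 1 (Real.exp (W ε - c)) ∂(fwdPathLaw ν₁ κR) =
      (∫⁻ ε, accR c W ε ∂(fwdPathLaw ν₁ κR)).toReal := by
    rw [integral_eq_lintegral_of_nonneg_ae
      (Eventually.of_forall fun ε => le_min zero_le_one (Real.exp_pos _).le) hmR.aestronglyMeasurable]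
    rfl
  rw [hF, hR, key, ENNReal.toReal_mul, ENNReal.toReal_ofReal (Real.exp_pos _).le]
  -- `Z₀ · e^{c−ΔF} = e^{c} Z₁`
  have hr : Real.exp (-ΔF) = (ν₀ univ).toReal⁻¹ * (ν₁ univ).toReal := by
    rw [hΔF, ENNReal.toReal_mul, ENNReal.toReal_inv]
  rw [sub_eq_add_neg, Real.exp_add, hr]
  field_simp

/-- **The same in occupancy form**: `(1 − p(c)) · a_F(c) = p(c) · a_R(c)` with
`p(c) = Π_c(target)/Π_c(everything)`. -/
theorem one_sub_occupancy_mul_accept_eq [IsFiniteMeasure ν₀] [IsFiniteMeasure ν₁] [IsMarkovKernel κF]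
    [IsMarkovKernel κR] (h0 : ν₀ univ ≠ 0) (h1 : ν₁ univ ≠ 0) (h : CrooksPair ν₀ ν₁ κF κR s e W)
    (c : ℝ) :
    (1 - (jointWeight c ν₀ ν₁ (targetLevel Ω)).toReal / (jointWeight c ν₀ ν₁ univ).toReal) *
        ∫ ε, min 1 (Real.exp (-(W ε - c))) ∂(fwdPathLaw ν₀ κF) =
      (jointWeight c ν₀ ν₁ (targetLevel Ω)).toReal / (jointWeight c ν₀ ν₁ univ).toReal *
        ∫ ε, min 1 (Real.exp (W ε - c)) ∂(fwdPathLaw ν₁ κR) := by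
  have hz0 : 0 < (ν₀ univ).toReal := ENNReal.toReal_pos h0 (measure_ne_top ν₀ univ)
  have hz1 : 0 < (ν₁ univ).toReal := ENNReal.toReal_pos h1 (measure_ne_top ν₁ univ)
  have hec : 0 < Real.exp c := Real.exp_pos c
  have htot : 0 < (ν₀ univ).toReal + Real.exp c * (ν₁ univ).toReal := by positivity
  have key := h.occupancy_mul_accept_rev_eq h0 h1 c
  rw [toReal_jointWeight_targetLevel, toReal_jointWeight_univ]
  rw [one_sub_div htot.ne', show (ν₀ univ).toReal + Real.exp c * (ν₁ univ).toReal -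
      Real.exp c * (ν₁ univ).toReal = (ν₀ univ).toReal by ring, div_mul_eq_mul_div, div_mul_eq_mul_div,
    key]

end CrooksPair

end Summit.Ventures.LatticeQCDFlow.Exactness.GeneralNCMC
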